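/- Fleet seat `ym-wcr-19608-p2` (g2), route `WeakCouplingRates`, cruxes `ColdBoxTwoPointFloorW` (stmt-QuantumFields-19608) and
`BulkDominatesColdBoxW` (stmt-QuantumFields-19609): the ϑ-DATUM pass of the one-scale trunk, TILT BOUND WITH DATUM (T4). -/
import Summits.QuantumFields.YangMills.Theorems.WeakCouplingRatesColdBoxDatumSplit
import Summits.QuantumFields.YangMills.Theorems.WeakCouplingRatesColdBoxTiltBound
import Summits.QuantumFields.YangMills.Theorems.WeakCouplingRatesBulkDominatesColdBoxWForestPoincareDatum

/-!
# The one-scale expansion with an exterior datum: small links and the tilt bound (T4)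

The ϑ-twin of `…ColdBoxLinkSmall` + `…ColdBoxTiltBound` (fleet lead `ym-wcr-19456-p1` g2): small plaquettes + SMALL EXTERIOR ⇒ small links, and
the tilt exponent with datum is uniformly small on the small-field event.  Hypotheses on the datum are GLOBAL off the cold box
`Λ = boxEdges 4 (2H+1)` (exterior links `P(1, ϑ_e)` with `Σ_c ϑ_{c,e}² ≤ r²` for EVERY `e ∉ Λ`; the assembler's truncated gauge copy is `1` far
away, i.e. `ϑ = 0` there) — the Poincaré ladder `ell_le_uniform_of_exterior_le` needs ALL plaquette holonomies small, and plaquettes off the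
box are products of four exterior links.

* `ell_hol_le_of_cost_le_of_exterior_le` — exterior links within `r`, touching plaquettes `≤ δ²` ⇒ every plaquette holonomy has `ℓ ≤ δ + 4r`;
* `su2_opDist1_le_of_cost_le_of_exterior_le` — … ⇒ every LINK has `‖ρ(V_e) − 1‖_op ≤ (12H²+2H+1)(δ + 8r)` (forest links `1`, `H ≥ 1`);
* `sum_sq_extDatum_le_of_plaqCost_le` / `sum_sq_extDatum_le_of_mem_goodTD` — **R1 with datum**: on `goodTD`, every chart coordinate of the data
  of `cfgTD t` (free, forest and exterior edges alike) has `Σ_k w̃_e,k² ≤ m²` for any `m` with `√2·(12H²+2H+1)(√(β^{2ε−1}) + 8r) ≤ m ≤ ¼`;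
* `abs_beta_mul_plaqCostAt_sub_qObsD_le_of_mem_goodTD` — **R3 with datum**: `|β·cost_p(cfgTD t) − qObsD p t| ≤ 362·β·m³` for every plaquette
  touching `Λ` (cubic chart remainder `abs_plaqCostAt_gnomonic_sub_sum_sq_le_of_forall` + T2a; needs `ϑ = 0` on the temporal forest);
* `abs_tiltWD_le_of_mem_goodTD` — **T4**: `|tiltWD β ϑ t| ≤ #(plaquettesTouching Λ)·362β·m³ + 2·#(ColdFreeIdx H)·m²` on `goodTD`
  (`m` as above; at `r = 0`, `m = √2(12H²+2H+1)√(β^{2ε−1})` this is the flat `abs_tiltW_le_of_mem_goodT`);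
* `beta_mul_plaqCostAt_lt_of_mem_goodTD` / `…mem_Icc…` — on `goodTD`, `0 ≤ β·cost_p(cfgTD t) ≤ β^{2ε}` for touching `p`.
No sorry; no new definition; standard axioms.  NOT a claim about the mass gap.
-/

set_option autoImplicit false

noncomputable section

open MeasureTheory Finset
open scoped ENNReal Matrix.Norms.L2Operator
open Literature.Probability.LatticeModels (Site)
open Literature.MathematicalPhysics
open Literature.MathematicalPhysics.QuantumLattice
open Literature.MathematicalPhysics.QuantumFieldTheory
open Literature.MathematicalPhysics.QuantumFieldTheory.LatticeMaxwell
open Literature.MathematicalPhysics.QuantumFieldTheory.AxialGauge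
open Literature.MathematicalPhysics.QuantumFieldTheory.Balaban1983to89
open Literature.MathematicalPhysics.QuantumFieldTheory.Balaban1983to89.UnitaryModel

namespace Summit.QuantumFields.YangMills.Theorems.WeakCouplingRates

variable {H : ℕ}

/-! ## Small plaquettes + small exterior ⇒ small links (`SU(2)`, temporal-forest gauge) -/

/-- Reading `coldGoodSet` on any configuration: every plaquette touching the cold box costs `< β^{2ε−1}`. -/
theorem mem_coldGoodSet_iff (β ε : ℝ) (U : LGConfig 4 (Matrix.specialUnitaryGroup (Fin 2) ℂ)) :
    U ∈ coldGoodSet β ε H ↔ ∀ p ∈ plaquettesTouching (boxEdges 4 (2 * H + 1)),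
      plaqCostAt (fundamentalRep (Fin 2)) p.1 p.2.1.1 p.2.1.2 U < β ^ (2 * ε - 1) := by
  simp only [coldGoodSet, Set.mem_compl_iff, Set.mem_setOf_eq, not_exists, not_and, not_le, plaqCostAt, Nat.cast_ofNat]

/-- A chart point `P(1, v)` with `Σ_c v_c² ≤ m²` is within `m` of `1` in operator norm (`cost ≤ |v|²` and `ℓ² = cost` on `SU(2)`). -/
theorem opDist1_gnomonicChart_le {v : Fin 3 → ℝ} {m : ℝ} (hm : 0 ≤ m) (hv : ∑ c, v c ^ 2 ≤ m ^ 2) :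
    opDist1 (fundamentalRep (Fin 2) (gnomonicChart v)) ≤ m := by
  refine opDist1_fundamentalRep_le_of_cost_le hm ?_
  have h := (two_sub_trace_re_gnomonic_bounds v).2
  rw [gnomonicChart]
  exact h.trans hv

/-- **Every plaquette holonomy is `ℓ`-small with a small exterior**: if every exterior link of `V` is within `r` of `1` and every plaquette
touching the cold box costs `≤ δ²`, then every plaquette holonomy of `ℤ⁴` (all `x i j`) has `ℓ ≤ δ + 4r` (plaquettes off the box are
products of four exterior links; degenerate ones are `1`; reversed ones are inverses). -/
theorem ell_hol_le_of_cost_le_of_exterior_le (V : LGConfig 4 (Matrix.specialUnitaryGroup (Fin 2) ℂ)) {r δ : ℝ} (hr : 0 ≤ r)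
    (hδ : 0 ≤ δ) (hout : ∀ e, e ∉ boxEdges 4 (2 * H + 1) → opDist1 (fundamentalRep (Fin 2) (V e)) ≤ r)
    (hcost : ∀ p ∈ plaquettesTouching (boxEdges 4 (2 * H + 1)),
      plaqCostAt (fundamentalRep (Fin 2)) p.1 p.2.1.1 p.2.1.2 V ≤ δ ^ 2)
    (x : Site 4) (i j : Fin 4) : opDist1 (fundamentalRep (Fin 2) (plaquetteHolonomyZd V x i j)) ≤ δ + 4 * r := by
  have hρu : ∀ g : Matrix.specialUnitaryGroup (Fin 2) ℂ, fundamentalRep (Fin 2) g ∈ Matrix.unitaryGroup (Fin 2) ℂ :=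
    fundamentalRep_mem_unitaryGroup
  -- the case `i < j`
  have hlt : ∀ i j : Fin 4, i < j → opDist1 (fundamentalRep (Fin 2) (plaquetteHolonomyZd V x i j)) ≤ δ + 4 * r := by
    intro i j hij
    by_cases hp : ((x, ⟨(i, j), hij⟩) : ZdPlaquette 4) ∈ plaquettesTouching (boxEdges 4 (2 * H + 1))
    · have h := hcost _ hp
      rw [plaqCostAt_eq_two_sub_trace] at h
      have := opDist1_fundamentalRep_le_of_cost_le hδ h
      simp only at this
      linarith [mul_nonneg (by norm_num : (0 : ℝ) ≤ 4) hr]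
    · -- all four edges are exterior
      rw [mem_plaquettesTouching_iff, Finset.not_nonempty_iff_eq_empty] at hp
      have hnot : ∀ e ∈ plaquetteEdges ((x, ⟨(i, j), hij⟩) : ZdPlaquette 4), e ∉ boxEdges 4 (2 * H + 1) := fun e he hmem => by
        have : e ∈ plaquetteEdges ((x, ⟨(i, j), hij⟩) : ZdPlaquette 4) ∩ boxEdges 4 (2 * H + 1) := Finset.mem_inter.2 ⟨he, hmem⟩
        rw [hp] at this; simp at this
      have h1 := hout _ (hnot (x, i) (by simp [plaquetteEdges]))
      have h2 := hout _ (hnot (x + Pi.single i 1, j) (by simp [plaquetteEdges]))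
      have h3 := hout _ (hnot (x + Pi.single j 1, i) (by simp [plaquetteEdges]))
      have h4 := hout _ (hnot (x, j) (by simp [plaquetteEdges]))
      have e1 := opDist1_map_mul_le (fundamentalRep (Fin 2)) hρu (V (x, i) * V (x + Pi.single i 1, j) * (V (x + Pi.single j 1, i))⁻¹)
        (V (x, j))⁻¹
      have e2 := opDist1_map_mul_le (fundamentalRep (Fin 2)) hρu (V (x, i) * V (x + Pi.single i 1, j)) (V (x + Pi.single j 1, i))⁻¹
      have e3 := opDist1_map_mul_le (fundamentalRep (Fin 2)) hρu (V (x, i)) (V (x + Pi.single i 1, j))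
      rw [opDist1_map_inv _ hρu] at e1 e2
      rw [plaquetteHolonomyZd]
      linarith
  rcases lt_trichotomy i j with hij | rfl | hji
  · exact hlt i j hij
  · have : plaquetteHolonomyZd V x i i = 1 := by simp [plaquetteHolonomyZd]
    rw [this, map_one, opDist1_one]
    positivity
  · rw [plaquetteHolonomyZd_swap, opDist1_map_inv _ fundamentalRep_mem_unitaryGroup]
    exact hlt j i hji

/-- **Small plaquettes + small exterior ⇒ small links (`SU(2)`)**: exterior links within `r` of `1`, forest links `1`, touching
plaquettes `≤ δ²` (`H ≥ 1`) ⇒ EVERY link has `‖ρ(V_e) − 1‖_op ≤ (12H²+2H+1)·(δ + 8r)` (the Poincaré ladder with small exterior,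
`ell_le_uniform_of_exterior_le`, at `M = δ + 4r`). -/
theorem su2_opDist1_le_of_cost_le_of_exterior_le (hH : 1 ≤ H) (V : LGConfig 4 (Matrix.specialUnitaryGroup (Fin 2) ℂ)) {r δ : ℝ}
    (hr : 0 ≤ r) (hδ : 0 ≤ δ) (hout : ∀ e, e ∉ boxEdges 4 (2 * H + 1) → opDist1 (fundamentalRep (Fin 2) (V e)) ≤ r)
    (hforest : ∀ x : Site 4, (∀ k : Fin 4, 1 ≤ x k ∧ x k + 1 ≤ 2 * (H : ℤ)) → V (x, 0) = 1)
    (hcost : ∀ p ∈ plaquettesTouching (boxEdges 4 (2 * H + 1)),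
      plaqCostAt (fundamentalRep (Fin 2)) p.1 p.2.1.1 p.2.1.2 V ≤ δ ^ 2)
    (e : Literature.MathematicalPhysics.QuantumLattice.ZdEdge 4) :
    opDist1 (fundamentalRep (Fin 2) (V e)) ≤ (12 * (H : ℝ) ^ 2 + 2 * H + 1) * (δ + 8 * r) := by
  have hρu : ∀ g : Matrix.specialUnitaryGroup (Fin 2) ℂ, fundamentalRep (Fin 2) g ∈ Matrix.unitaryGroup (Fin 2) ℂ :=
    fundamentalRep_mem_unitaryGroup
  have h := ell_le_uniform_of_exterior_le (fun g => opDist1 (fundamentalRep (Fin 2) g))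
    (by simp only [map_one]; exact UnitaryModel.opDist1_one)
    (fun x y => opDist1_map_mul_le (fundamentalRep (Fin 2)) hρu x y)
    (fun x => opDist1_map_inv (fundamentalRep (Fin 2)) hρu x)
    (fun x g => opDist1_map_conj (fundamentalRep (Fin 2)) hρu g x)
    V hout hforest (ell_hol_le_of_cost_le_of_exterior_le V hr hδ hout hcost) hH hr e
  have : (12 * (H : ℝ) ^ 2 + 2 * H + 1) * (δ + 4 * r + 4 * r) = (12 * (H : ℝ) ^ 2 + 2 * H + 1) * (δ + 8 * r) := by ring
  rw [← this]; exact h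

/-- **The sup-norm chart-coordinate bound with datum**: for the chart configuration `chartCfgD ϑ w` with exterior datum
`Σ_c ϑ_{c,e}² ≤ r²` off the cold box, if every plaquette touching the box costs `≤ δ²` and `L² ≤ ½` for `L = (12H²+2H+1)(δ + 8r)`, then
EVERY chart coordinate (free, forest, exterior) has `Σ_k (extDatum ϑᵀ w e k)² ≤ 2L²`. -/
theorem sum_sq_extDatum_le_of_plaqCost_le (hH : 1 ≤ H) (ϑ : Fin 3 → (Literature.MathematicalPhysics.QuantumLattice.ZdEdge 4 → ℝ))
    (w : ColdFreeIdx H → (Fin 3 → ℝ)) {r δ : ℝ} (hr : 0 ≤ r) (hδ : 0 ≤ δ)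
    (hϑ : ∀ e, e ∉ boxEdges 4 (2 * H + 1) → ∑ c, ϑ c e ^ 2 ≤ r ^ 2)
    (hsmall : ((12 * (H : ℝ) ^ 2 + 2 * H + 1) * (δ + 8 * r)) ^ 2 ≤ 1 / 2)
    (hcost : ∀ p ∈ plaquettesTouching (boxEdges 4 (2 * H + 1)),
      plaqCostAt (fundamentalRep (Fin 2)) p.1 p.2.1.1 p.2.1.2 (chartCfgD ϑ w) ≤ δ ^ 2)
    (e : Literature.MathematicalPhysics.QuantumLattice.ZdEdge 4) :
    ∑ k, extDatum (fun e c => ϑ c e) w e k ^ 2 ≤ 2 * ((12 * (H : ℝ) ^ 2 + 2 * H + 1) * (δ + 8 * r)) ^ 2 := by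
  set V := chartCfgD ϑ w with hV
  have hout : ∀ e, e ∉ boxEdges 4 (2 * H + 1) → opDist1 (fundamentalRep (Fin 2) (V e)) ≤ r := by
    intro e he
    rw [hV, chartCfgD_of_not_mem _ _ he]
    exact opDist1_gnomonicChart_le hr (hϑ e he)
  have hforest : ∀ x : Site 4, (∀ k : Fin 4, 1 ≤ x k ∧ x k + 1 ≤ 2 * (H : ℤ)) → V (x, 0) = 1 := fun x hx => chartCfgD_of_forest _ _ hx
  have hlink := su2_opDist1_le_of_cost_le_of_exterior_le hH V hr hδ hout hforest hcost e
  have hcostlink := cost_le_of_opDist1_fundamentalRep_le hlink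
  have hVe : V e = quatToSU2 (gnomonicQuat (extDatum (fun e c => ϑ c e) w e)) := rfl
  rw [hVe] at hcostlink
  have key := sum_sq_le_two_mul_cost (hcostlink.trans hsmall)
  linarith

/-! ## On `goodTD`: the link bound, the per-plaquette linearisation, and the tilt bound (T4) -/

/-- **R1 with datum on `goodTD`**: for `t ∈ goodTD` and any `m` with `√2·(12H²+2H+1)(√(β^{2ε−1}) + 8r) ≤ m ≤ ¼`, every chart coordinate
of the data of `cfgTD t` has `Σ_k w̃_e,k² ≤ m²`. -/
theorem sum_sq_extDatum_le_of_mem_goodTD {β ε r m : ℝ} (hβ : 0 < β) (hH : 1 ≤ H) (hr : 0 ≤ r)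
    {ϑ : Fin 3 → (Literature.MathematicalPhysics.QuantumLattice.ZdEdge 4 → ℝ)}
    (hϑ : ∀ e, e ∉ boxEdges 4 (2 * H + 1) → ∑ c, ϑ c e ^ 2 ≤ r ^ 2)
    (hm : Real.sqrt 2 * ((12 * (H : ℝ) ^ 2 + 2 * H + 1) * (Real.sqrt (β ^ (2 * ε - 1)) + 8 * r)) ≤ m) (hm4 : m ≤ 1 / 4)
    {t : TSpace H} (ht : t ∈ goodTD H β ε ϑ) (e : Literature.MathematicalPhysics.QuantumLattice.ZdEdge 4) :
    ∑ k, extDatum (fun e c => ϑ c e) (unscaleT H β (t + meanT H β ϑ)) e k ^ 2 ≤ m ^ 2 := by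
  set L : ℝ := (12 * (H : ℝ) ^ 2 + 2 * H + 1) * (Real.sqrt (β ^ (2 * ε - 1)) + 8 * r) with hL
  have hL0 : 0 ≤ L := by positivity
  have h2 : Real.sqrt 2 ^ 2 = 2 := Real.sq_sqrt (by norm_num)
  have hm0 : 0 ≤ m := le_trans (by positivity) hm
  have hsq : 2 * L ^ 2 ≤ m ^ 2 := by
    have h1 : (Real.sqrt 2 * L) ^ 2 ≤ m ^ 2 := pow_le_pow_left₀ (by positivity) hm 2
    rw [mul_pow, h2] at h1
    exact h1
  have hsmall : L ^ 2 ≤ 1 / 2 := by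
    have : m ^ 2 ≤ (1 / 4) ^ 2 := pow_le_pow_left₀ hm0 hm4 2
    nlinarith
  have hcost : ∀ p ∈ plaquettesTouching (boxEdges 4 (2 * H + 1)), plaqCostAt (fundamentalRep (Fin 2)) p.1 p.2.1.1 p.2.1.2
      (chartCfgD ϑ (unscaleT H β (t + meanT H β ϑ))) ≤ Real.sqrt (β ^ (2 * ε - 1)) ^ 2 := by
    intro p hp
    rw [Real.sq_sqrt (Real.rpow_nonneg hβ.le _)]
    exact ((mem_coldGoodSet_iff β ε _).1 ht p hp).le
  have key := sum_sq_extDatum_le_of_plaqCost_le hH ϑ (unscaleT H β (t + meanT H β ϑ)) hr (Real.sqrt_nonneg _) hϑ hsmall hcost e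
  exact key.trans hsq

/-- **R3 with datum on `goodTD`**: for every plaquette `p` touching the cold box, `|β·cost_p(cfgTD t) − qObsD p t| ≤ 362·β·m³`. -/
theorem abs_beta_mul_plaqCostAt_sub_qObsD_le_of_mem_goodTD {β ε r m : ℝ} (hβ : 0 < β) (hH : 1 ≤ H) (hr : 0 ≤ r)
    {ϑ : Fin 3 → (Literature.MathematicalPhysics.QuantumLattice.ZdEdge 4 → ℝ)}
    (hϑ : ∀ e, e ∉ boxEdges 4 (2 * H + 1) → ∑ c, ϑ c e ^ 2 ≤ r ^ 2)
    (hforest : ∀ x : Site 4, (∀ k : Fin 4, 1 ≤ x k ∧ x k + 1 ≤ 2 * (H : ℤ)) → ∀ c, ϑ c (x, 0) = 0)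
    (hm : Real.sqrt 2 * ((12 * (H : ℝ) ^ 2 + 2 * H + 1) * (Real.sqrt (β ^ (2 * ε - 1)) + 8 * r)) ≤ m) (hm4 : m ≤ 1 / 4)
    {t : TSpace H} (ht : t ∈ goodTD H β ε ϑ) {p : ZdPlaquette 4} (hp : p ∈ plaquettesTouching (boxEdges 4 (2 * H + 1))) :
    |β * plaqCostAt (fundamentalRep (Fin 2)) p.1 p.2.1.1 p.2.1.2 (cfgTD H β ϑ t) - qObsD H β ϑ (p.1, p.2.1.1, p.2.1.2) t| ≤
      362 * β * m ^ 3 := by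
  have hm0 : 0 ≤ m := le_trans (by positivity) hm
  have hw := sum_sq_extDatum_le_of_mem_goodTD hβ hH hr hϑ hm hm4 ht
  have key := abs_plaqCostAt_gnomonic_sub_sum_sq_le_of_forall (extDatum (fun e c => ϑ c e) (unscaleT H β (t + meanT H β ϑ)))
    hm0 hm4 hw p.1 p.2.1.1 p.2.1.2
  rw [← beta_mul_sum_sCirc_extDatum_sq_eq hβ ϑ hforest t hp, ← mul_sub, abs_mul, abs_of_pos hβ]
  have hcfg : cfgTD H β ϑ t = fun e => gnomonicChart (extDatum (fun e c => ϑ c e) (unscaleT H β (t + meanT H β ϑ)) e) := rfl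
  rw [hcfg]
  calc β * |_| ≤ β * (362 * m ^ 3) := mul_le_mul_of_nonneg_left key hβ.le
    _ = 362 * β * m ^ 3 := by ring

/-- **T4 — the tilt exponent with datum is uniformly small on `goodTD`**: for any `m` with
`√2·(12H²+2H+1)(√(β^{2ε−1}) + 8r) ≤ m ≤ ¼`, `|tiltWD β ϑ t| ≤ #(plaquettesTouching Λ)·362β·m³ + 2·#(ColdFreeIdx H)·m²` (cubic remainders
over the touching plaquettes + the gnomonic log-Jacobian `|log (1+s)⁻²| ≤ 2s` over the free links).  At `r = 0` this is the flat
`abs_tiltW_le_of_mem_goodT`. -/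
theorem abs_tiltWD_le_of_mem_goodTD {β ε r m : ℝ} (hβ : 0 < β) (hH : 1 ≤ H) (hr : 0 ≤ r)
    {ϑ : Fin 3 → (Literature.MathematicalPhysics.QuantumLattice.ZdEdge 4 → ℝ)}
    (hϑ : ∀ e, e ∉ boxEdges 4 (2 * H + 1) → ∑ c, ϑ c e ^ 2 ≤ r ^ 2)
    (hforest : ∀ x : Site 4, (∀ k : Fin 4, 1 ≤ x k ∧ x k + 1 ≤ 2 * (H : ℤ)) → ∀ c, ϑ c (x, 0) = 0)
    (hm : Real.sqrt 2 * ((12 * (H : ℝ) ^ 2 + 2 * H + 1) * (Real.sqrt (β ^ (2 * ε - 1)) + 8 * r)) ≤ m) (hm4 : m ≤ 1 / 4)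
    {t : TSpace H} (ht : t ∈ goodTD H β ε ϑ) :
    |tiltWD H β ϑ t| ≤
      (#(plaquettesTouching (boxEdges 4 (2 * H + 1))) : ℝ) * (362 * β * m ^ 3) + 2 * (Fintype.card (ColdFreeIdx H) : ℝ) * m ^ 2 := by
  set τ : ℝ := 362 * β * m ^ 3 with hτ
  rw [tiltWD]
  refine (abs_add_le _ _).trans (add_le_add ?_ ?_)
  · -- plaquette terms
    refine (Finset.abs_sum_le_sum_abs _ _).trans ?_
    have hterm : ∀ q ∈ plaquettesTouching (boxEdges 4 (2 * H + 1)),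
        |qObsD H β ϑ (q.1, q.2.1.1, q.2.1.2) t - β * plaqCostAt (fundamentalRep (Fin 2)) q.1 q.2.1.1 q.2.1.2 (cfgTD H β ϑ t)| ≤ τ := by
      intro q hq
      rw [abs_sub_comm]
      exact abs_beta_mul_plaqCostAt_sub_qObsD_le_of_mem_goodTD hβ hH hr hϑ hforest hm hm4 ht hq
    calc ∑ q ∈ plaquettesTouching (boxEdges 4 (2 * H + 1)),
          |qObsD H β ϑ (q.1, q.2.1.1, q.2.1.2) t - β * plaqCostAt (fundamentalRep (Fin 2)) q.1 q.2.1.1 q.2.1.2 (cfgTD H β ϑ t)|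
        ≤ ∑ q ∈ plaquettesTouching (boxEdges 4 (2 * H + 1)), τ := Finset.sum_le_sum hterm
      _ = _ := by rw [Finset.sum_const, nsmul_eq_mul]
  · -- Jacobian terms
    refine (Finset.abs_sum_le_sum_abs _ _).trans ?_
    have hterm : ∀ e : ColdFreeIdx H, |Real.log (((1 + ∑ i, (unscaleT H β (t + meanT H β ϑ) e i) ^ 2)⁻¹) ^ 2)| ≤ 2 * m ^ 2 := by
      intro e
      have hs0 : 0 ≤ ∑ i, (unscaleT H β (t + meanT H β ϑ) e i) ^ 2 := Finset.sum_nonneg fun i _ => sq_nonneg _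
      have hle : ∑ i, (unscaleT H β (t + meanT H β ϑ) e i) ^ 2 ≤ m ^ 2 := by
        have := sum_sq_extDatum_le_of_mem_goodTD hβ hH hr hϑ hm hm4 ht e.1.1
        simpa only [extDatum_apply_free] using this
      calc |Real.log (((1 + ∑ i, (unscaleT H β (t + meanT H β ϑ) e i) ^ 2)⁻¹) ^ 2)| ≤
          2 * ∑ i, (unscaleT H β (t + meanT H β ϑ) e i) ^ 2 := abs_log_gnomonicDensity_le hs0
        _ ≤ 2 * m ^ 2 := by linarith
    calc ∑ e : ColdFreeIdx H, |Real.log (((1 + ∑ i, (unscaleT H β (t + meanT H β ϑ) e i) ^ 2)⁻¹) ^ 2)| ≤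
        ∑ _e : ColdFreeIdx H, 2 * m ^ 2 := Finset.sum_le_sum fun e _ => hterm e
      _ = _ := by rw [Finset.sum_const, nsmul_eq_mul, Finset.card_univ]; ring

/-- On `goodTD`, `β·cost_p(cfgTD t) < β^{2ε}` for every plaquette touching the box (`β > 0`). -/
theorem beta_mul_plaqCostAt_lt_of_mem_goodTD {β ε : ℝ} (hβ : 0 < β) {ϑ : Fin 3 → (Literature.MathematicalPhysics.QuantumLattice.ZdEdge 4 → ℝ)}
    {t : TSpace H} (ht : t ∈ goodTD H β ε ϑ) {p : ZdPlaquette 4} (hp : p ∈ plaquettesTouching (boxEdges 4 (2 * H + 1))) :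
    β * plaqCostAt (fundamentalRep (Fin 2)) p.1 p.2.1.1 p.2.1.2 (cfgTD H β ϑ t) < β ^ (2 * ε) := by
  have h := (mem_coldGoodSet_iff β ε (cfgTD H β ϑ t)).1 ht p hp
  have hsplit : β ^ (2 * ε) = β * β ^ (2 * ε - 1) := by
    rw [show (2 : ℝ) * ε = 1 + (2 * ε - 1) by ring, Real.rpow_add hβ, Real.rpow_one]
    ring_nf
  rw [hsplit]
  exact mul_lt_mul_of_pos_left h hβ

/-- On `goodTD`, `0 ≤ β·cost_p(cfgTD t) ≤ β^{2ε}` for every plaquette touching the box. -/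
theorem beta_mul_plaqCostAt_mem_Icc_of_mem_goodTD {β ε : ℝ} (hβ : 0 < β)
    {ϑ : Fin 3 → (Literature.MathematicalPhysics.QuantumLattice.ZdEdge 4 → ℝ)} {t : TSpace H} (ht : t ∈ goodTD H β ε ϑ)
    {p : ZdPlaquette 4} (hp : p ∈ plaquettesTouching (boxEdges 4 (2 * H + 1))) :
    0 ≤ β * plaqCostAt (fundamentalRep (Fin 2)) p.1 p.2.1.1 p.2.1.2 (cfgTD H β ϑ t) ∧
      β * plaqCostAt (fundamentalRep (Fin 2)) p.1 p.2.1.1 p.2.1.2 (cfgTD H β ϑ t) ≤ β ^ (2 * ε) :=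
  ⟨mul_nonneg hβ.le (plaqCostAt_nonneg _ _ _ _), (beta_mul_plaqCostAt_lt_of_mem_goodTD hβ ht hp).le⟩

end Summit.QuantumFields.YangMills.Theorems.WeakCouplingRates

end
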